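import Literature.MathematicalPhysics.QuantumFieldTheory.Balaban1983to89.B9SectBQLettersL2Y
import Literature.MathematicalPhysics.QuantumFieldTheory.Balaban1983to89.B9SectBGWordDeltaAQY

/-!
# Balaban [B9], (3.12)–(3.13) p. 393, (3.26) p. 395, (3.80) p. 406 in block-`ℓ²` at a GENERIC averaging pair `(𝔮, 𝔮s)` — the ℓ² coded letters
# `QbQC2 ∕ QsbQC2 ∕ F₂QC2 ∕ F₂sQC2` (print's block volume symmetrized) and ★ the product identity `QsbQC2·abC·QbQC2 = QsbQC·abC·QbQC`
# (CASCADE-K piece «K2-G», stage B3; the `(𝔮, 𝔮s)`-edition of `B9SectBQLettersL2Y` §1–§2)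

T. Bałaban, *Propagators for lattice gauge theories in a background field*, Commun. Math. Phys. **99** (1985) 389–434
[`Balaban1985BackgroundPropagators`, "B9"]; [4] = [`Balaban1984PropagatorsII`]; [B8] = [`Balaban1985Averaging`].

statement-level skeleton of published theorems with citation tags; proofs where landed; nothing here is a claim about the Yang–Mills mass gap

WHY THIS FILE (seat dag-n06-c gen 25; «⚑ K2-G SCOPE» stage M3).  The (3.46)–(3.47) frame `L2GFrame₈` reads ℓ² letters `Qb2 ∕ Qsb2 ∕ F₂2 ∕ F₂s2` with the
law `q2_prod : Qsb2·ab·Qb2 = Qsb·ab·Qb` (the concrete `Δ_a` unchanged) and ℓ² size laws; `B9SectBQLettersL2Y` typed them at the straight `QY parB`.  THIS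
FILE is the generic edition: `QbQY2 𝔮 U := ext ∘ diag(√vol) ∘ 𝔮 U`, `QsbQY2 𝔮s U := 𝔮s U ∘ diag(√vol) ∘ res`, the conj-`b` codings `QbQC2 ∕ QsbQC2`, the (3.80)
differences `F₂QC2 ∕ F₂sQC2` (`qbQC2_prod ∕ qsbQC2_prod` definitional), ★ `qQY2_prod ∕ qQC2_prod` (proofs verbatim: `res ∘ ext = id`, `√v·(w∕v)·√v = v·(w∕v)`);
§3 the straight instance by `rfl`.  The ℓ² SIZE laws ((3.15) in ℓ², `B9SectBQLettersL2Y` §4 at `QY`) are DISPLAYED downstream (`hQL2`), not typed here.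

HONEST SCOPE.  Definitions and exact identities between defined objects; no estimate; nothing of [B9] asserted; count-neutral; N06 NOT discharged; nothing
continuum ∕ OS ∕ mass-gap ∕ Clay.  No `sorry`, no `axiom`, no `instance`, no `notation`.  `--supports stmt-QuantumFields-27364`.

RELATED IN THE TREE, NOT DUPLICATED: `B9SectBQLettersL2Y` (the `QY` edition; `sqv`, `liftMatY_diagonal_comp(_comp)` USED), `B9SectBGWordDeltaAQY` (stage A:
`QbQY ∕ QsbVQY ∕ QbQC ∕ QsbQC`).
-/

noncomputable section

namespace Literature.MathematicalPhysics.QuantumFieldTheory.Balaban1983to89.B9SectBQLettersL2QY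

open B6KLevelCensusIndexV1 (KIdx kGeo)
open B9Eq352DivFormLetters (conj)
open B9Eq360DeltaPrimeAY (AfldY)
open B9SectBGpLettersY (decY)
open B9SectBCodedCarrier (CCfg)
open B9SectBGWordDeltaAY (restrictScalars_mul' volY volY_pos abVY abC)
open B9SectBGWordDeltaAQY (QbQY QsbVQY QbQC QsbQC)
open B9SectBQLettersL2Y (sqv liftMatY_diagonal_comp liftMatY_diagonal_comp_comp QbY2 QsbY2 QbC2 QsbC2 F₂C2 F₂sC2)
open Node00 (SiteY BlkY FBondY IBondY CfgY BondParY QY QsY liftMatY extBondY resBondY resBondY_comp_extBondY bondOpCoordsY)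

variable {d ℓ : ℕ} {hd : 1 ≤ d + 1} {hL : Odd (ℓ + 1) ∧ 1 < ℓ + 1} {b₀ b₁ : ℝ}
variable {𝔸 : Type} [NormedRing 𝔸] [NormedAlgebra ℂ 𝔸] [CompleteSpace 𝔸]
variable {ι : Type} [Fintype ι]
variable (i : KIdx d ℓ hd hL b₀ b₁) (𝔮 : CfgY 𝔸 i → ((FBondY i → 𝔸) →ₗ[ℂ] (IBondY i → 𝔸)))
  (𝔮s : CfgY 𝔸 i → ((IBondY i → 𝔸) →ₗ[ℂ] (FBondY i → 𝔸))) (parB : BondParY 𝔸 i) (b : Module.Basis ι ℝ 𝔸)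

/-! ## §1 The `ℓ²` letters of the pair `(𝔮, 𝔮s)`: the block volume symmetrized -/

section Letters

/-- **`Qb2 = ext ∘ √vol ∘ 𝔮(U)`** on `𝔸`-valued bond functions. [cite: Balaban1985BackgroundPropagators, (3.12)–(3.13) p.392; Balaban1984PropagatorsII, (2.20) p.226] -/
def QbQY2 (U : CfgY 𝔸 i) : Module.End ℂ (FBondY i → 𝔸) :=
  extBondY i ∘ₗ liftMatY 𝔸 (Matrix.diagonal (sqv i)) ∘ₗ 𝔮 U

/-- **`Qsb2 = 𝔮s(U) ∘ √vol ∘ res`**. [cite: Balaban1985BackgroundPropagators, (3.13) p.392; Balaban1984PropagatorsII, (2.19) p.226] -/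
def QsbQY2 (U : CfgY 𝔸 i) : Module.End ℂ (FBondY i → 𝔸) :=
  𝔮s U ∘ₗ liftMatY 𝔸 (Matrix.diagonal (sqv i)) ∘ₗ resBondY i

/-- `Qb2` in real bond coordinates at a coded configuration (at its decoding). [cite: Balaban1985BackgroundPropagators, (3.12) p.392, (3.26) p.395] -/
def QbQC2 (c : CCfg (CfgY 𝔸 i) (AfldY 𝔸 i)) : Module.End ℝ ((Fin (d + 1) × SiteY i) × ι → ℝ) :=
  conj b ((Node00.bondOpCoordsY i (QbQY2 i 𝔮 (decY i c))).restrictScalars ℝ)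

/-- `Qsb2` in real bond coordinates. [cite: Balaban1985BackgroundPropagators, (3.13) p.392, (3.26) p.395] -/
def QsbQC2 (c : CCfg (CfgY 𝔸 i) (AfldY 𝔸 i)) : Module.End ℝ ((Fin (d + 1) × SiteY i) × ι → ℝ) :=
  conj b ((Node00.bondOpCoordsY i (QsbQY2 i 𝔮s (decY i c))).restrictScalars ℝ)

/-- `F₂2(A) = Qb2(U′U) − Qb2(U)` at a (base, multiplier) pair, `0` elsewhere. [cite: Balaban1985BackgroundPropagators, (3.80) p.406] -/
def F₂QC2 : CCfg (CfgY 𝔸 i) (AfldY 𝔸 i) → CCfg (CfgY 𝔸 i) (AfldY 𝔸 i) → Module.End ℝ ((Fin (d + 1) × SiteY i) × ι → ℝ)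
  | .base U, .mult a => QbQC2 i 𝔮 b (.prod U a) - QbQC2 i 𝔮 b (.base U)
  | _, _ => 0

/-- `F₂*2(A) = Qsb2(U′U) − Qsb2(U)`. [cite: Balaban1985BackgroundPropagators, (3.80) p.406] -/
def F₂sQC2 : CCfg (CfgY 𝔸 i) (AfldY 𝔸 i) → CCfg (CfgY 𝔸 i) (AfldY 𝔸 i) → Module.End ℝ ((Fin (d + 1) × SiteY i) × ι → ℝ)
  | .base U, .mult a => QsbQC2 i 𝔮s b (.prod U a) - QsbQC2 i 𝔮s b (.base U)
  | _, _ => 0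

/-- (3.80) at the new letters: `Qb2(e^{iηa}U) = Qb2(U) + F₂2(a)`. [cite: Balaban1985BackgroundPropagators, (3.80) p.406] -/
theorem qbQC2_prod (U : CfgY 𝔸 i) (a : AfldY 𝔸 i) : QbQC2 i 𝔮 b (.prod U a) = QbQC2 i 𝔮 b (.base U) + F₂QC2 i 𝔮 b (.base U) (.mult a) := by
  simp only [F₂QC2, add_sub_cancel]

/-- (3.80), second half: `Qsb2(e^{iηa}U) = Qsb2(U) + F₂*2(a)`. [cite: Balaban1985BackgroundPropagators, (3.80) p.406] -/
theorem qsbQC2_prod (U : CfgY 𝔸 i) (a : AfldY 𝔸 i) : QsbQC2 i 𝔮s b (.prod U a) = QsbQC2 i 𝔮s b (.base U) + F₂sQC2 i 𝔮s b (.base U) (.mult a) := by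
  simp only [F₂sQC2, add_sub_cancel]

end Letters

/-! ## §2 The product identity: the concrete `Δ_a[𝔮]` is the same at the two letter systems -/

section Product

/-- ★ **THE PRODUCT IDENTITY ON `𝔸`-VALUED BOND FUNCTIONS**: `QsbY2 ∘ abVY ∘ QbY2 = QsbVY ∘ abVY ∘ QbY` (`res ∘ ext = id`, `√v·(w∕v)·√v = v·(w∕v)`).
[cite: Balaban1985BackgroundPropagators, (3.26) p.395 («Q*aQ»), (3.12)–(3.13) p.392] -/
theorem qQY2_prod (U : CfgY 𝔸 i) : QsbQY2 i 𝔮s U ∘ₗ abVY (𝔸 := 𝔸) i ∘ₗ QbQY2 i 𝔮 U = QsbVQY i 𝔮s U ∘ₗ abVY (𝔸 := 𝔸) i ∘ₗ QbQY i 𝔮 U := by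
  classical
  simp only [QsbQY2, QbQY2, QsbVQY, abVY, QbQY, LinearMap.comp_assoc]
  -- cancel `res ∘ ext` (twice on the left, once on the right) and merge the diagonals
  have e2 : ∀ (w : IBondY i → ℝ) (S : (FBondY i → 𝔸) →ₗ[ℂ] (IBondY i → 𝔸)),
      resBondY (𝔸 := 𝔸) i ∘ₗ (extBondY i ∘ₗ (liftMatY 𝔸 (Matrix.diagonal w) ∘ₗ S)) = liftMatY 𝔸 (Matrix.diagonal w) ∘ₗ S := fun w S => by
    rw [← LinearMap.comp_assoc, resBondY_comp_extBondY]; rfl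
  have e3 : resBondY (𝔸 := 𝔸) i ∘ₗ (extBondY i ∘ₗ 𝔮 U) = 𝔮 U := by
    rw [← LinearMap.comp_assoc, resBondY_comp_extBondY]; rfl
  have hfun : (sqv i * fun κ => i.w κ / volY i κ) * sqv i = volY i * fun κ => i.w κ / volY i κ := by
    funext κ
    simp only [Pi.mul_apply, sqv]
    rw [mul_comm (Real.sqrt (volY i κ)) (i.w κ / volY i κ), mul_assoc, Real.mul_self_sqrt (volY_pos i κ).le, mul_comm]
  rw [e2, e2, e2, e3, liftMatY_diagonal_comp_comp, liftMatY_diagonal_comp_comp, liftMatY_diagonal_comp_comp, hfun]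

/-- the same in the ring `Module.End`. [cite: Balaban1985BackgroundPropagators, (3.26) p.395, bookkeeping] -/
theorem qQY2_prod_mul (U : CfgY 𝔸 i) : QsbQY2 i 𝔮s U * abVY (𝔸 := 𝔸) i * QbQY2 i 𝔮 U = QsbVQY i 𝔮s U * abVY (𝔸 := 𝔸) i * QbQY i 𝔮 U := by
  simp only [Module.End.mul_eq_comp, LinearMap.comp_assoc]
  exact qQY2_prod i 𝔮 𝔮s U

/-- ★ **THE PRODUCT IDENTITY AT THE conj-`b` LETTERS**: `QsbC2·abC·QbC2 = QsbC·abC·QbC` at every coded configuration (the law `q2_prod` of `L2GFrame₈`).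
[cite: Balaban1985BackgroundPropagators, (3.26) p.395] -/
theorem qQC2_prod (c : CCfg (CfgY 𝔸 i) (AfldY 𝔸 i)) : QsbQC2 i 𝔮s b c * abC (𝔸 := 𝔸) i b * QbQC2 i 𝔮 b c = QsbQC i 𝔮s b c * abC (𝔸 := 𝔸) i b * QbQC i 𝔮 b c := by
  rw [QsbQC2, QbQC2, QsbQC, QbQC, abC, ← B9Eq352DivFormLetters.conj_mul, ← B9Eq352DivFormLetters.conj_mul, ← B9Eq352DivFormLetters.conj_mul,
    ← B9Eq352DivFormLetters.conj_mul, ← restrictScalars_mul', ← restrictScalars_mul', ← restrictScalars_mul', ← restrictScalars_mul',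
    ← Node00.bondOpCoordsY_mul, ← Node00.bondOpCoordsY_mul, ← Node00.bondOpCoordsY_mul, ← Node00.bondOpCoordsY_mul, qQY2_prod_mul]

end Product

/-! ## §3 The straight instance (`rfl`) -/

section Instance

/-- FACE: `QbQY2 (QY parB) = QbY2 parB`. [cite: Balaban1985BackgroundPropagators, (3.12) p.392, bookkeeping] -/
theorem QbQY2_QY : QbQY2 i (QY i parB) = QbY2 i parB := rfl

/-- FACE: `QsbQY2 (QsY parB) = QsbY2 parB`. [cite: Balaban1985BackgroundPropagators, (3.13) p.392, bookkeeping] -/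
theorem QsbQY2_QsY : QsbQY2 i (QsY i parB) = QsbY2 i parB := rfl

/-- FACE: `QbQC2 (QY parB) = QbC2 parB`. [cite: Balaban1985BackgroundPropagators, (3.12) p.392, bookkeeping] -/
theorem QbQC2_QY : QbQC2 i (QY i parB) b = QbC2 i parB b := rfl

/-- FACE: `QsbQC2 (QsY parB) = QsbC2 parB`. [cite: Balaban1985BackgroundPropagators, (3.13) p.392, bookkeeping] -/
theorem QsbQC2_QsY : QsbQC2 i (QsY i parB) b = QsbC2 i parB b := rfl

/-- FACE: `F₂QC2 (QY parB) = F₂C2 parB`. [cite: Balaban1985BackgroundPropagators, (3.80) p.406, bookkeeping] -/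
theorem F₂QC2_QY : F₂QC2 i (QY i parB) b = F₂C2 i parB b := by
  funext c c'; cases c <;> cases c' <;> rfl

/-- FACE: `F₂sQC2 (QsY parB) = F₂sC2 parB`. [cite: Balaban1985BackgroundPropagators, (3.80) p.406, bookkeeping] -/
theorem F₂sQC2_QsY : F₂sQC2 i (QsY i parB) b = F₂sC2 i parB b := by
  funext c c'; cases c <;> cases c' <;> rfl

end Instance

end Literature.MathematicalPhysics.QuantumFieldTheory.Balaban1983to89.B9SectBQLettersL2QY

end
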